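import Summits.HodgeConjecture.HodgeConjecture.Theorems.Ring2AbelianAllAndreFibreOrientationTransport
import Summits.HodgeConjecture.HodgeConjecture.Theorems.Ring2AbelianAllAndreSubmersionLinearChart
import Summits.HodgeConjecture.HodgeConjecture.Theorems.Ring2AbelianAllAndreFibreClassOnPath
import Literature.AlgebraicGeometry.HodgeTheory.SmoothFamilyFibreClasses
import Literature.AlgebraicTopology.SingularHomology.IntToCoeffClassNaturality
import HarnessLib

/-!
# Ring 2 · sub-cell AbelianAll (ALL ABELIAN VARIETIES), André axis, part XIII-e — THE FIBRE CLASS OF A SMOOTH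
# PROJECTIVE FAMILY DOES NOT DEPEND ON THE FIBRE: the named fact `Fulton1998_map_fundamentalClass_fibre_eq`
# (Fulton, *Intersection Theory*, Prop. 19.1.1 for the fibres of a family) PROVED on the tree's carriers

HONEST FRAMING (page 1, verbatim): **research route, not a corollary; conditional on HC_CM plus one named
minimal statement.** Cell line: research route conditional on HC_CM; not a corollary; Q11.4-sentence-2
already refuted in dim ≥ 3. Nothing in this file proves a case of the Hodge conjecture. Seat
`pub-hodge-ring2-ab-andre-2`, gen 5.

## What is proved

**`fulton1998_map_fundamentalClass_fibre_eq_holds : Fulton1998_map_fundamentalClass_fibre_eq`** — the lit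
seat's named fact (`HodgeTheory/SmoothFamilyFibreClasses`, "no cycle map / specialisation / base change on
the carriers"): for every smooth projective family `f : 𝒳 ⟶ S` of relative dimension `n` over a smooth
projective base and all complex points `t, t'` of `S`, `j_t(ℂ)_* [𝒳_t(ℂ)] = j_{t'}(ℂ)_* [𝒳_{t'}(ℂ)]` in
`H_{2n}(𝒳(ℂ); ℂ)` for the complex orientations. PROOF (Fulton §19.1 proof of Prop. 19.1.1 "since `T` is
connected, `cl(V_t)` is independent of `t`", carried out topologically as in Voisin I §9.1.1 + §11.1.2):

1. `S(ℂ)` is connected (SGA1 XII 2.4, the tree's `connectedSpace_complexPoints`), so it suffices that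
   `t ↦ j_{t*}[𝒳_t]` is LOCALLY constant (`fibreClass_eventually_eq`).
2. Ehresmann (the tree's `isLocallyTrivialFibration_map_of_smoothOfRelativeDimension`, Voisin I Thm. 9.3)
   trivialises `f(ℂ)` over an open `V ∋ t₀`; normalised at `t₀` it is an ambient isotopy
   `Θ : V × 𝒳_{t₀}(ℂ) → 𝒳(ℂ)` of injections, `Θ(t₀, ·) = j_{t₀}`, `Θ(b, ·)` a homeomorphism onto
   `f(ℂ)⁻¹(b) ≅ 𝒳_b(ℂ)` (`exists_fibreTransport`); along a path from `t₀` to `u` inside a contractible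
   chart neighbourhood this is a homotopy `j_{t₀} ≃ j_u ∘ Ψ_u` (`Ψ_u : 𝒳_{t₀}(ℂ) ≃ 𝒳_u(ℂ)`), so
   `j_{u*} Ψ_{u*} = j_{t₀*}` (homotopy invariance, Hatcher Thm. 2.10).
3. **`Ψ_{u*}[𝒳_{t₀}] = [𝒳_u]` for the COMPLEX orientations** — the one point where the complex structure
   enters: in the fibrewise holomorphic coordinates `q = p ∘ a_Q` of part XIII-c, `Ψ_u` is the end of an
   isotopy through injections from the identity, of local degree `+1` at one point (part XIII-d
   `map_localClass_eq_of_fibre_isotopy`), hence of degree `1` (Hatcher Thm. 3.26 / Ex. 8, the tree's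
   `hasDegree_one_of_map_localClass_eq`; `map_fundamentalClass_eq_of_map_localClass_eq`).

Consequence for the cell (§4): **the André axis' last supply node (φ) `FibreClassConstantCompactPencils` is a
TREE THEOREM** (`fibreClassConstantCompactPencils_holds`, through lit's
`IsCompactAbelianPencil.complexGysin_fiberι_one_eq`); the fact-free rows follow in part XIII-f. Everything is
proved; 0 `sorry`; no new definitions; the named fact is DISCHARGED (net debt −1).

## References

* [Fulton1998] W. Fulton, Intersection Theory, 2nd ed., Springer 1998, §10.3 Ex. 10.3.2, §19.1 Prop. 19.1.1
  (with proof), Lemma 19.1.3.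
* [VoisinHodgeI2002] C. Voisin, Hodge Theory and Complex Algebraic Geometry I, CUP 2002, Thm. 9.3, §9.1.1,
  §9.2.1, §11.1.2.
* [HatcherAT2002] A. Hatcher, Algebraic Topology, CUP 2002, Thm. 2.10, §3.3 Thm. 3.26, Exercise 8.
* [MilnorStasheff1974] J. Milnor, J. Stasheff, Characteristic Classes, PUP 1974, §13 p. 151.
* [SGA1] A. Grothendieck, M. Raynaud, SGA 1, Exp. XII Prop. 2.4, Prop. 3.1 (iv).
* [BrockerJanichIDT1982] Th. Bröcker, K. Jänich, Introduction to Differential Topology, (8.12).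
-/

noncomputable section

set_option linter.dupNamespace false

namespace Summit.HodgeConjecture.HodgeConjecture.Ring2.AbelianAll

open CategoryTheory AlgebraicGeometry Set Filter Topology
open scoped ContDiff unitInterval
open Literature.AlgebraicGeometry Literature.AlgebraicGeometry.Motives
open Literature.AlgebraicGeometry.HodgeTheory
open Literature.AlgebraicTopology.SingularHomology
open Literature.AlgebraicTopology.Homotopy (IsLocallyTrivialFibration)

/-! ## §1 Degree one for the complex orientations from the local class identity -/

section DegreeOne

variable {n : ℕ} {X' X : SchemeOver ℂ}

/-- **A map of smooth projective `n`-folds' complex points carrying the complex local orientation class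
at one point `a` (the only point over its image) to the one at its image has degree `1` for the complex
orientation family**: `ψ_* [X'(ℂ)] = [X(ℂ)]` in `H_{2n}(X(ℂ); ℂ)` (Hatcher Thm. 3.26 (b) / Exercise 8 via the
tree's `hasDegree_one_of_map_localClass_eq` over `ℚ`, then `fundamentalClass_complexOrientationFamily`).
[cite: HatcherAT2002, §3.3 Thm. 3.26 and Exercise 8] [cite: VoisinHodgeI2002, §11.1.2] -/
theorem map_fundamentalClass_eq_of_map_localClass_eq (hX' : IsSmoothProjective n X')
    (hX : IsSmoothProjective n X) (ψ : C(ComplexPoints X', ComplexPoints X)) {a : ComplexPoints X'}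
    (hfib : MapsTo ψ ({a}ᶜ : Set (ComplexPoints X')) ({ψ a}ᶜ : Set (ComplexPoints X)))
    (h : relativeSingularHomology.map ℤ ℤ ψ hfib (2 * n) ((complexOrientationInt hX').localClass a) =
      (complexOrientationInt hX).localClass (ψ a)) :
    singularHomology.map ℂ ℂ ψ (2 * n) (complexOrientationFamily hX').fundamentalClass =
      (complexOrientationFamily hX).fundamentalClass := by
  letI := hX'.chartedSpace
  letI := hX.chartedSpace
  haveI := ComplexPoints.compactSpace_of_isSmoothProjective hX'
  haveI := ComplexPoints.compactSpace_of_isSmoothProjective hX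
  haveI := ComplexPoints.t2Space_of_isSmoothProjective hX'
  haveI := ComplexPoints.t2Space_of_isSmoothProjective hX
  haveI := connectedSpace_complexPoints hX
  have hQ := HomologicalOrientation.map_toCoeff_localClass ℚ ψ hfib (complexOrientationInt hX')
    (complexOrientationInt hX) h
  have hdeg : HasDegree (complexOrientationRat hX') (complexOrientationRat hX) ψ 1 :=
    hasDegree_one_of_map_localClass_eq ψ hfib _ _ hQ
  rw [HasDegree, one_zsmul] at hdeg
  rw [fundamentalClass_complexOrientationFamily, fundamentalClass_complexOrientationFamily,
    ← singularHomology.coeffChange_map, hdeg]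

end DegreeOne

/-! ## §2 Ehresmann's trivialisation, normalised at `t₀`: the fibre transport -/

section Transport

variable {𝒳 S : SchemeOver ℂ} (f : 𝒳 ⟶ S) [IsProper f.left] [IsSeparated 𝒳.hom]

/-- **The fibre transport of a local trivialisation, normalised at `t₀`.** From a topological
trivialisation `φ : V × f(ℂ)⁻¹(t₀) ≃ f(ℂ)⁻¹(V)` over `V` (Ehresmann, Voisin I Thm. 9.3) one gets a jointly
continuous `Θ : V × 𝒳_{t₀}(ℂ) → 𝒳(ℂ)`, `Θ(b, x) = φ(b, pr₂ φ⁻¹(j_{t₀} x))`, with `Θ(t₀, ·) = j_{t₀}`, `Θ(b, ·)`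
injective with values in `f(ℂ)⁻¹(b)`, and for every `b ∈ V` a homeomorphism `Ψ_b : 𝒳_{t₀}(ℂ) ≃ 𝒳_b(ℂ)` with
`j_b ∘ Ψ_b = Θ(b, ·)` (the scheme-theoretic fibres being the topological ones, the tree's `fiberHomeomorph`).
[cite: VoisinHodgeI2002, Thm. 9.3 and §9.1.1] [cite: BrockerJanichIDT1982, (8.12)] -/
theorem exists_fibreTransport {V : Set (ComplexPoints S)} {t₀ : ComplexPoints S} (ht₀ : t₀ ∈ V)
    (φ : ↥V × ↥((AlgPoints.map f : ComplexPoints 𝒳 → ComplexPoints S) ⁻¹' {t₀}) ≃ₜ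
      ↥((AlgPoints.map f : ComplexPoints 𝒳 → ComplexPoints S) ⁻¹' V))
    (hφ : ∀ x, AlgPoints.map f (φ x : ComplexPoints 𝒳) = (x.1 : ComplexPoints S)) :
    ∃ Θ : ↥V × ComplexPoints (fiberOver f t₀) → ComplexPoints 𝒳, Continuous Θ ∧
      (∀ x, Θ (⟨t₀, ht₀⟩, x) = AlgPoints.map (fiberι f t₀) x) ∧
      (∀ b x, AlgPoints.map f (Θ (b, x)) = (b : ComplexPoints S)) ∧
      (∀ b : ↥V, Function.Injective fun x => Θ (b, x)) ∧
      ∀ b : ↥V, ∃ Ψ : ComplexPoints (fiberOver f t₀) ≃ₜ ComplexPoints (fiberOver f (b : ComplexPoints S)),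
        ∀ x, AlgPoints.map (fiberι f (b : ComplexPoints S)) (Ψ x) = Θ (b, x) := by
  -- the first component of `φ⁻¹ z` is `f(ℂ) z`
  have key0 : ∀ z : ↥((AlgPoints.map f : ComplexPoints 𝒳 → ComplexPoints S) ⁻¹' V),
      ((φ.symm z).1 : ComplexPoints S) = AlgPoints.map f (z : ComplexPoints 𝒳) := by
    intro z
    rw [← hφ (φ.symm z), φ.apply_symm_apply]
  -- the slices `c ↦ φ (b, c) : f⁻¹ t₀ ≃ f⁻¹ b`
  have hmemb : ∀ (b : ↥V) (c : ↥((AlgPoints.map f : ComplexPoints 𝒳 → ComplexPoints S) ⁻¹' {t₀})),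
      (φ (b, c) : ComplexPoints 𝒳) ∈
        (AlgPoints.map f : ComplexPoints 𝒳 → ComplexPoints S) ⁻¹' {(b : ComplexPoints S)} :=
    fun b c => hφ (b, c)
  have hmemV : ∀ (b : ↥V)
      (z : ↥((AlgPoints.map f : ComplexPoints 𝒳 → ComplexPoints S) ⁻¹' {(b : ComplexPoints S)})),
      (z : ComplexPoints 𝒳) ∈ (AlgPoints.map f : ComplexPoints 𝒳 → ComplexPoints S) ⁻¹' V := by
    intro b z
    have hz : AlgPoints.map f (z : ComplexPoints 𝒳) = b := z.2
    change AlgPoints.map f (z : ComplexPoints 𝒳) ∈ V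
    rw [hz]
    exact b.2
  let slice : ∀ b : ↥V, ↥((AlgPoints.map f : ComplexPoints 𝒳 → ComplexPoints S) ⁻¹' {t₀}) ≃ₜ ↥((AlgPoints.map f : ComplexPoints 𝒳 → ComplexPoints S) ⁻¹' {(b : ComplexPoints S)}) := fun b =>
    { toFun := fun c => ⟨(φ (b, c) : ComplexPoints 𝒳), hmemb b c⟩
      invFun := fun z => (φ.symm ⟨(z : ComplexPoints 𝒳), hmemV b z⟩).2
      left_inv := fun c => by
        have h1 : (⟨(φ (b, c) : ComplexPoints 𝒳), hmemV b ⟨_, hmemb b c⟩⟩ : ↥((AlgPoints.map f : ComplexPoints 𝒳 → ComplexPoints S) ⁻¹' V)) = φ (b, c) :=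
          Subtype.ext rfl
        change (φ.symm ⟨(φ (b, c) : ComplexPoints 𝒳), _⟩).2 = c
        rw [h1, φ.symm_apply_apply]
      right_inv := fun z => by
        apply Subtype.ext
        change (φ (b, (φ.symm ⟨(z : ComplexPoints 𝒳), hmemV b z⟩).2) : ComplexPoints 𝒳) = z
        have h1 : (φ.symm ⟨(z : ComplexPoints 𝒳), hmemV b z⟩).1 = b := by
          apply Subtype.ext
          rw [key0]
          exact z.2
        have h2 : (b, (φ.symm ⟨(z : ComplexPoints 𝒳), hmemV b z⟩).2) =
            φ.symm ⟨(z : ComplexPoints 𝒳), hmemV b z⟩ := Prod.ext h1.symm rfl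
        rw [h2, φ.apply_symm_apply]
      continuous_toFun := (continuous_subtype_val.comp (φ.continuous.comp
        (continuous_const.prodMk continuous_id))).subtype_mk _
      continuous_invFun := continuous_snd.comp (φ.symm.continuous.comp
        (continuous_subtype_val.subtype_mk _)) }
  have slice_apply : ∀ (b : ↥V) (c : ↥((AlgPoints.map f : ComplexPoints 𝒳 → ComplexPoints S) ⁻¹' {t₀})), ((slice b c : ↥((AlgPoints.map f : ComplexPoints 𝒳 → ComplexPoints S) ⁻¹' {(b : ComplexPoints S)})) :
      ComplexPoints 𝒳) = φ (b, c) := fun b c => rfl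
  -- the scheme-theoretic fibres are the topological fibres
  let fH : ∀ t : ComplexPoints S, ComplexPoints (fiberOver f t) ≃ₜ ↥((AlgPoints.map f : ComplexPoints 𝒳 → ComplexPoints S) ⁻¹' {t}) := fun t =>
    fiberHomeomorph f t
  have fH_apply : ∀ t x, ((fH t x : ↥((AlgPoints.map f : ComplexPoints 𝒳 → ComplexPoints S) ⁻¹' {t})) : ComplexPoints 𝒳) = AlgPoints.map (fiberι f t) x :=
    fun t x => rfl
  -- the normalised transport
  set t₀' : ↥V := ⟨t₀, ht₀⟩ with ht₀'
  refine ⟨fun bx => ((slice bx.1 ((slice t₀').symm (fH t₀ bx.2)) : ↥((AlgPoints.map f : ComplexPoints 𝒳 → ComplexPoints S) ⁻¹' {(bx.1 : ComplexPoints S)})) :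
      ComplexPoints 𝒳), ?_, ?_, ?_, ?_, ?_⟩
  · -- continuity
    change Continuous fun bx : ↥V × ComplexPoints (fiberOver f t₀) =>
      (φ (bx.1, (slice t₀').symm (fH t₀ bx.2)) : ComplexPoints 𝒳)
    exact continuous_subtype_val.comp (φ.continuous.comp (continuous_fst.prodMk
      ((slice t₀').symm.continuous.comp ((fH t₀).continuous.comp continuous_snd))))
  · -- normalisation at `t₀`
    intro x
    change ((slice t₀' ((slice t₀').symm (fH t₀ x)) :
      ↥((AlgPoints.map f : ComplexPoints 𝒳 → ComplexPoints S) ⁻¹' {t₀})) : ComplexPoints 𝒳) = _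
    rw [(slice t₀').apply_symm_apply]
    rfl
  · -- fibrewise
    intro b x
    exact (slice b ((slice t₀').symm (fH t₀ x))).2
  · -- injective
    intro b x x' hxx'
    have h1 : slice b ((slice t₀').symm (fH t₀ x)) = slice b ((slice t₀').symm (fH t₀ x')) :=
      Subtype.ext hxx'
    exact (fH t₀).injective ((slice t₀').symm.injective ((slice b).injective h1))
  · -- the homeomorphisms `Ψ_b`
    intro b
    refine ⟨(fH t₀).trans ((slice t₀').symm.trans ((slice b).trans (fH (b : ComplexPoints S)).symm)), fun x => ?_⟩
    rw [← fH_apply]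
    change (((fH (b : ComplexPoints S)) ((fH (b : ComplexPoints S)).symm
      (slice b ((slice t₀').symm (fH t₀ x)))) : ↥((AlgPoints.map f : ComplexPoints 𝒳 → ComplexPoints S) ⁻¹' {(b : ComplexPoints S)})) : ComplexPoints 𝒳) = _
    rw [(fH (b : ComplexPoints S)).apply_symm_apply]

end Transport

/-! ## §3 Local constancy of the fibre class, and the named fact -/

section Constancy

variable {n m N : ℕ} {𝒳 S : SchemeOver ℂ} {f : 𝒳 ⟶ S}

/-- **The fibre class `j_{t*}[𝒳_t(ℂ)] ∈ H_{2n}(𝒳(ℂ); ℂ)` is locally constant in `t`** (for the complex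
orientation family): every `t₀` has a neighbourhood on which `j_{u*}[𝒳_u] = j_{t₀*}[𝒳_{t₀}]` — Ehresmann
transport (`exists_fibreTransport`) along paths in a contractible chart neighbourhood gives the homotopy
`j_{t₀} ≃ j_u ∘ Ψ_u`, and `Ψ_u` has degree `1` for the complex orientations (part XIII-d + §1).
[cite: Fulton1998, §19.1 proof of Prop. 19.1.1] [cite: VoisinHodgeI2002, Thm. 9.3, §9.1.1 and §11.1.2]
[cite: HatcherAT2002, Thm. 2.10 and §3.3 Thm. 3.26] -/
theorem fibreClass_eventually_eq (hS : IsSmoothProjective m S) (hf : IsSmoothProjectiveFamily f n)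
    (t₀ : ComplexPoints S) :
    ∀ᶠ u in 𝓝 t₀,
      singularHomology.map ℂ ℂ (AlgPoints.mapContinuous (L := ℂ) (fiberι f u)) (2 * n)
          (complexOrientationFamily (hf.isSmoothProjective u)).fundamentalClass =
        singularHomology.map ℂ ℂ (AlgPoints.mapContinuous (L := ℂ) (fiberι f t₀)) (2 * n)
          (complexOrientationFamily (hf.isSmoothProjective t₀)).fundamentalClass := by
  classical
  -- instances on the base, the morphism, the total space and the fibres
  haveI : IsProper S.hom := IsSmoothProjective.isProper_holds hS
  haveI : CompactSpace S.left := QuasiCompact.compactSpace_of_compactSpace S.hom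
  haveI := hS.smoothOfRelativeDimension
  haveI : IsProper f.left := hf.isProper
  haveI := hf.smoothOfRelativeDimension
  haveI : Smooth f.left := hf.smooth
  haveI : IsSeparated 𝒳.hom := by rw [← Over.w f]; infer_instance
  haveI : IsProper 𝒳.hom := by rw [← Over.w f]; infer_instance
  haveI : SmoothOfRelativeDimension (n + m) 𝒳.hom :=
    ComplexPoints.smoothOfRelativeDimension_hom_of_hom f n m
  haveI : CompactSpace 𝒳.left := QuasiCompact.compactSpace_of_compactSpace f.left
  haveI : SecondCountableTopology (ComplexPoints 𝒳) :=
    ComplexPoints.secondCountableTopology_of_compactSpace_holds 𝒳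
  haveI : SecondCountableTopology (ComplexPoints S) :=
    ComplexPoints.secondCountableTopology_of_compactSpace_holds S
  have hXt : ∀ t, IsSmoothProjective n (fiberOver f t) := hf.isSmoothProjective
  haveI : ∀ t, IsProper (fiberOver f t).hom := fun t => IsSmoothProjective.isProper_holds (hXt t)
  haveI : ∀ t, SmoothOfRelativeDimension n (fiberOver f t).hom := fun t => (hXt t).smoothOfRelativeDimension
  letI := hS.chartedSpace
  set F : ComplexPoints 𝒳 → ComplexPoints S := AlgPoints.map f with hF
  set jm : ∀ t, C(ComplexPoints (fiberOver f t), ComplexPoints 𝒳) := fun t =>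
    AlgPoints.mapContinuous (L := ℂ) (fiberι f t) with hjm
  -- a point of the (non-empty, connected) fibre over `t₀`
  haveI := connectedSpace_complexPoints (hXt t₀)
  obtain ⟨x₀⟩ := (inferInstance : Nonempty (ComplexPoints (fiberOver f t₀)))
  set Q : ComplexPoints 𝒳 := AlgPoints.map (fiberι f t₀) x₀ with hQ
  -- part XIII-c: a fibrewise-injective linear chart `q = p ∘ a_Q` on `W ∋ Q`
  obtain ⟨W, p, hWo, hQW, hWa, hinj⟩ := exists_fibrewise_injOn_linear_chart (n := n + m) (m := m) f Q
    (d := n) rfl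
  -- Ehresmann over `V ∋ t₀`, normalised: the transport `Θ`
  obtain ⟨V, hVo, ht₀V, φ, hφ⟩ :=
    ComplexPoints.isLocallyTrivialFibration_map_of_smoothOfRelativeDimension n m f t₀
  obtain ⟨Θ, hΘc, hΘ0, hΘF, hΘinj, hΨ⟩ := exists_fibreTransport f ht₀V φ hφ
  -- a product neighbourhood `V₁ × K₀` of `(t₀, x₀)` kept inside `W` by `Θ`
  have hpre : Θ ⁻¹' W ∈ 𝓝 ((⟨t₀, ht₀V⟩ : ↥V), x₀) := by
    apply hΘc.continuousAt.preimage_mem_nhds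
    rw [hΘ0]
    exact hWo.mem_nhds hQW
  obtain ⟨A, hA, K, hK, hAK⟩ := mem_nhds_prod_iff.1 hpre
  obtain ⟨V₁, hV₁, hV₁A⟩ := (mem_nhds_subtype V ⟨t₀, ht₀V⟩ A).1 hA
  obtain ⟨K₀, hK₀K, hK₀o, hx₀K₀⟩ := mem_nhds_iff.1 hK
  -- a contractible open `B ∋ t₀` inside `V ∩ V₁`
  obtain ⟨B, hBo, ht₀B, hBsub, hBc⟩ := exists_isOpen_contractibleSpace_of_chartedSpace (d := 2 * m) t₀
    (V ∩ V₁) (inter_mem (hVo.mem_nhds ht₀V) hV₁)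
  have hBV : B ⊆ V := fun b hb => (hBsub hb).1
  have hΘW : ∀ (b : ↥B), ∀ x ∈ K₀, Θ (⟨(b : ComplexPoints S), hBV b.2⟩, x) ∈ W := by
    intro b x hx
    have h1 : ((⟨(b : ComplexPoints S), hBV b.2⟩ : ↥V), x) ∈ A ×ˢ K :=
      ⟨hV₁A (show ((⟨(b : ComplexPoints S), hBV b.2⟩ : ↥V) : ComplexPoints S) ∈ V₁ from (hBsub b.2).2),
        hK₀K hx⟩
    exact hAK h1
  -- for `u ∈ B`: transport along a path from `t₀` to `u` inside `B`
  filter_upwards [hBo.mem_nhds ht₀B] with u huB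
  haveI := hBc
  let γ : Path (⟨t₀, ht₀B⟩ : ↥B) ⟨u, huB⟩ := PathConnectedSpace.somePath _ _
  set θ : I × ComplexPoints (fiberOver f t₀) → ComplexPoints 𝒳 := fun sx =>
    Θ (⟨((γ sx.1 : ↥B) : ComplexPoints S), hBV (γ sx.1).2⟩, sx.2) with hθdef
  have hθc : Continuous θ :=
    hΘc.comp (((continuous_subtype_val.comp (γ.continuous.comp continuous_fst)).subtype_mk _).prodMk
      continuous_snd)
  have hθ0 : ∀ x, θ (0, x) = AlgPoints.map (fiberι f t₀) x := by
    intro x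
    change Θ (⟨((γ 0 : ↥B) : ComplexPoints S), hBV (γ 0).2⟩, x) = _
    rw [← hΘ0 x]
    congr 2
    exact Subtype.ext (by rw [γ.source])
  have hθinj : ∀ s : I, Function.Injective fun x => θ (s, x) := fun s x x' h => hΘinj _ h
  have hθF : ∀ (s : I) (x x' : ComplexPoints (fiberOver f t₀)), F (θ (s, x)) = F (θ (s, x')) := by
    intro s x x'
    change F (Θ (_, x)) = F (Θ (_, x'))
    rw [hF, hΘF, hΘF]
  have hθW : ∀ (s : I), ∀ x ∈ K₀, θ (s, x) ∈ W := fun s x hx => hΘW (γ s) x hx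
  obtain ⟨Ψ, hΨu⟩ := hΨ ⟨u, hBV huB⟩
  have hΨθ : ∀ x, AlgPoints.map (fiberι f u) (Ψ x) = θ (1, x) := by
    intro x
    rw [hΨu x]
    change Θ (⟨u, hBV huB⟩, x) = Θ (⟨((γ 1 : ↥B) : ComplexPoints S), hBV (γ 1).2⟩, x)
    congr 2
    exact Subtype.ext (by rw [γ.target])
  -- part XIII-d: `Ψ` carries the complex local class at `x₀` to the one at `Ψ x₀`
  have hloc := map_localClass_eq_of_fibre_isotopy (n := n) (N := n + m) Q hWo hWa p hinj θ hθc hθ0 hθinj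
    hθF hK₀o hx₀K₀ hθW Ψ hΨθ
  have hloc' : relativeSingularHomology.map ℤ ℤ
      (Ψ : C(ComplexPoints (fiberOver f t₀), ComplexPoints (fiberOver f u)))
      (mapsTo_compl_singleton_of_injective Ψ.injective rfl) (2 * n)
      ((complexOrientationInt (hXt t₀)).localClass x₀) = (complexOrientationInt (hXt u)).localClass (Ψ x₀) := by
    exact hloc
  -- hence degree one for the complex orientations
  have hdeg : singularHomology.map ℂ ℂ
      (Ψ : C(ComplexPoints (fiberOver f t₀), ComplexPoints (fiberOver f u))) (2 * n)
      (complexOrientationFamily (hXt t₀)).fundamentalClass =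
      (complexOrientationFamily (hXt u)).fundamentalClass :=
    map_fundamentalClass_eq_of_map_localClass_eq (hXt t₀) (hXt u) _ (a := x₀) _ hloc'
  -- the homotopy `j_{t₀} ≃ j_u ∘ Ψ`
  let G : ContinuousMap.Homotopy (jm t₀) ((jm u).comp (Ψ : C(_, _))) :=
    { toFun := θ
      continuous_toFun := hθc
      map_zero_left := fun x => hθ0 x
      map_one_left := fun x => (hΨθ x).symm }
  have hhom := singularHomology.map_eq_of_homotopic (R := ℂ) (M := ℂ) ⟨G⟩ (2 * n)
  change singularHomology.map ℂ ℂ (jm u) (2 * n) (complexOrientationFamily (hXt u)).fundamentalClass =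
    singularHomology.map ℂ ℂ (jm t₀) (2 * n) (complexOrientationFamily (hXt t₀)).fundamentalClass
  rw [hhom, singularHomology.map_comp, ModuleCat.comp_apply, hdeg]

/-- **Fulton's Prop. 19.1.1 for the fibres of a smooth projective family, PROVED: the named fact
`Fulton1998_map_fundamentalClass_fibre_eq` of `HodgeTheory/SmoothFamilyFibreClasses` holds** — for every
smooth projective family `f : 𝒳 ⟶ S` of relative dimension `n` over a smooth projective (geometrically
irreducible) base and all complex points `t, t'`, `j_t(ℂ)_* [𝒳_t(ℂ)] = j_{t'}(ℂ)_* [𝒳_{t'}(ℂ)]` in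
`H_{2n}(𝒳(ℂ); ℂ)` (complex orientation family): the class is locally constant in `t`
(`fibreClass_eventually_eq`) and `S(ℂ)` is connected (SGA1 XII 2.4). The named fact is thereby DISCHARGED.
[cite: Fulton1998, §19.1 Prop. 19.1.1 (with proof) and Lemma 19.1.3] [cite: VoisinHodgeI2002, Thm. 9.3 and §11.1.2]
[cite: SGA1, Exp. XII Prop. 2.4] -/
theorem fulton1998_map_fundamentalClass_fibre_eq_holds : Fulton1998_map_fundamentalClass_fibre_eq := by
  intro n m N 𝒳 S f hS hf _ t t'
  haveI := connectedSpace_complexPoints hS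
  have hlc : IsLocallyConstant fun u : ComplexPoints S =>
      singularHomology.map ℂ ℂ (AlgPoints.mapContinuous (L := ℂ) (fiberι f u)) (2 * n)
        (complexOrientationFamily (hf.isSmoothProjective u)).fundamentalClass :=
    (IsLocallyConstant.iff_eventually_eq _).2 fun t₀ => fibreClass_eventually_eq hS hf t₀
  exact hlc.apply_eq_of_isPreconnected isPreconnected_univ (mem_univ t) (mem_univ t')

end Constancy

/-! ## §4 The supply node (φ) holds -/

section SupplyNode

variable {𝒳 S : SchemeOver ℂ}

/-- **(φ_f) holds on every compact pencil of abelian varieties**: `j_{t*} 1_{𝒳_t} = j_{t'*} 1_{𝒳_{t'}}` in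
`H²(𝒳(ℂ); ℂ)` for all complex points `t, t'` of the base curve (lit's `IsCompactAbelianPencil.complexGysin_fiberι_one_eq`
over the PROVED fact `fulton1998_map_fundamentalClass_fibre_eq_holds`). [cite: Fulton1998, §19.1 Prop. 19.1.1 (with proof)] -/
theorem fibreClassConstantOn_holds {d : ℕ} {f : 𝒳 ⟶ S} (hf : IsCompactAbelianPencil f d) :
    FibreClassConstantOn hf :=
  fun t t' ↦ hf.complexGysin_fiberι_one_eq fulton1998_map_fundamentalClass_fibre_eq_holds t t'

/-- **(φ) `FibreClassConstantCompactPencils` HOLDS** — the last topological supply node of the André / Lefschetz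
column is a tree theorem. [cite: Fulton1998, §19.1 Prop. 19.1.1 (with proof)] -/
theorem fibreClassConstantCompactPencils_holds : FibreClassConstantCompactPencils :=
  fun _ _ _ _ hf ↦ fibreClassConstantOn_holds hf

end SupplyNode

end Summit.HodgeConjecture.HodgeConjecture.Ring2.AbelianAll

end
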